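import Summits.AtomisticToContinuum.Crystallization.Theses.SoftAnnulusKernel
import Summits.AtomisticToContinuum.Crystallization.Theorems.ExcessDecayLiouvilleCrysEnergyLimit

/-!
# `CrysEnergyLimit` for route SoftAnnulusKernel (item stmt-AtomisticToContinuum-18407)

Verbatim the shared statement stmt-AtomisticToContinuum-0626 (`E(N)/N → ⨅_Q e(Q)` for Lennard-Jones in
`d = 3`), proved as `crysEnergyLimit_proof`; the Props are definitionally equal.
-/

namespace Summit.AtomisticToContinuum.Crystallization.Theorems

/-- **CrysEnergyLimit (route SoftAnnulusKernel)**, by definitional unfolding from `crysEnergyLimit_proof`. -/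
theorem softAnnulusKernel_crysEnergyLimit_proof :
    Summit.AtomisticToContinuum.Crystallization.Theses.SoftAnnulusKernel.CrysEnergyLimit :=
  crysEnergyLimit_proof

end Summit.AtomisticToContinuum.Crystallization.Theorems
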